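import Summits.RiemannHypothesis.RiemannHypothesis.Theorems.JensenLogBandCanaryDefs
import Literature.Analysis.Complex.WindingCertificateAnchored

/-!
# E-CANARY-128 — D3 file 8b/9: quarter-anchored piece lists (generic): validity from per-segment step rules,
# endpoints, and the junction sums `Im (apJumps …) = (π/2)·(integer)`

RH-FREE, generic in the function `f`. A SEGMENT is `(s, e, d)` = the interval `[s, e]` of one edge carrying the
anchor `I^d`; `segList` turns a list of segments into the tree's anchored piece list `List (ℝ × ℂ)`
(`Literature.Analysis.Complex.HAPieces/VAPieces`). `haPieces_segList` / `vaPieces_segList`: chained segments each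
obeying Henrici's step rule `0 < Re (f/I^d)` give a VALID anchored piece list; `apLast_segList`,
`apLastAnchor_segList`; and the quarter bookkeeping: `im_anchorJump_I_pow` (`Im log (I^{d'}/I^{d}) = (π/2)·jumpVal d d'`)
and `im_apJumps_segList`. Used by `…CanaryFinal`. Nothing here bears on the truth of RH.
-/

-- D-0017: the doubled namespace is by design.
set_option linter.dupNamespace false
set_option autoImplicit false

noncomputable section

namespace Summit.RiemannHypothesis.RiemannHypothesis.Theorems.JensenPolynomials.LogBand.Canary

open Literature.Analysis.Complex Complex Set
open scoped Real

/-! ## Segments and their piece lists -/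

/-- A segment `(s, e, d)`: the sub-interval `[s, e]` of an edge with quarter anchor `I^d`. -/
abbrev Seg := ℝ × ℝ × ℕ

/-- The anchored piece list of a segment list: entry `(e, I^d)` per segment. -/
def segList : List Seg → List (ℝ × ℂ)
  | [] => []
  | (_, e, d) :: T => (e, I ^ d) :: segList T

/-- Chaining: the first segment starts at `y₀`, each next segment starts where the previous ends. -/
def Chained : ℝ → List Seg → Prop
  | _, [] => True
  | y₀, (s, e, _) :: T => s = y₀ ∧ Chained e T

/-- The labels of a segment list. -/
def segLabels : List Seg → List ℕ
  | [] => []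
  | (_, _, d) :: T => d :: segLabels T

/-- The last endpoint of a segment list started at `y₀`. -/
def segLast (y₀ : ℝ) : List Seg → ℝ
  | [] => y₀
  | (_, e, _) :: T => segLast e T

/-- `apLast` of a segment piece list is its last endpoint. -/
theorem apLast_segList : ∀ (y₀ : ℝ) (T : List Seg), apLast y₀ (segList T) = segLast y₀ T
  | _, [] => rfl
  | _, (_, e, _) :: T => by simp [segList, segLast, apLast_segList e T]

/-- **Vertical validity from segments.** Chained segments on the line `Re z = x`, each with `s ≤ e` and the step
rule `0 < Re (f(x + iy)/I^d)` for `y ∈ [s, e]`, form a valid `VAPieces` list. -/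
theorem vaPieces_segList {f : ℂ → ℂ} {x : ℝ} :
    ∀ (T : List Seg) (y₀ : ℝ), Chained y₀ T →
      (∀ g ∈ T, g.1 ≤ g.2.1 ∧ ∀ y ∈ Icc g.1 g.2.1, 0 < (f (x + y * I) / I ^ g.2.2).re) →
      VAPieces f x y₀ (segList T)
  | [], _, _, _ => trivial
  | (s, e, d) :: T, y₀, hc, hg => by
    obtain ⟨hs, hc'⟩ := hc
    have hg0 := hg (s, e, d) (by simp)
    refine ⟨by rw [← hs]; exact hg0.1, fun y hy => hg0.2 y (by rw [hs]; exact hy), ?_⟩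
    exact vaPieces_segList T e hc' (fun g hgT => hg g (by simp [hgT]))

/-- **Horizontal validity from segments.** The same on the line `Im z = y`. -/
theorem haPieces_segList {f : ℂ → ℂ} {y : ℝ} :
    ∀ (T : List Seg) (x₀ : ℝ), Chained x₀ T →
      (∀ g ∈ T, g.1 ≤ g.2.1 ∧ ∀ x ∈ Icc g.1 g.2.1, 0 < (f (x + y * I) / I ^ g.2.2).re) →
      HAPieces f y x₀ (segList T)
  | [], _, _, _ => trivial
  | (s, e, d) :: T, x₀, hc, hg => by
    obtain ⟨hs, hc'⟩ := hc
    have hg0 := hg (s, e, d) (by simp)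
    refine ⟨by rw [← hs]; exact hg0.1, fun x hx => hg0.2 x (by rw [hs]; exact hx), ?_⟩
    exact haPieces_segList T e hc' (fun g hgT => hg g (by simp [hgT]))

/-! ## Quarter anchors: junction terms are integer multiples of `π/2` -/

/-- The quarter-turn count from anchor `I^d` to anchor `I^{d'}`: `0, 1, 2, −1` according to `(d' + 3d) mod 4`
(`I^{d'}/I^{d} = I^{d' + 3d}`). In a valid certificate the value `2` never occurs, but nothing here needs that. -/
def jumpVal (d d' : ℕ) : ℤ :=
  if (d' + 3 * d) % 4 = 0 then 0 else if (d' + 3 * d) % 4 = 1 then 1 else if (d' + 3 * d) % 4 = 2 then 2 else -1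

/-- `I^{d'} / I^{d} = I^{(d' + 3d) mod 4}`. -/
theorem I_pow_div_I_pow (d d' : ℕ) : I ^ d' / I ^ d = I ^ ((d' + 3 * d) % 4) := by
  rw [← Complex.I_pow_eq_pow_mod, pow_add, div_eq_mul_inv]
  congr 1
  rw [pow_mul, show I ^ 3 = I⁻¹ by rw [Complex.inv_I, pow_succ, pow_two, Complex.I_mul_I]; ring, inv_pow]

/-- `arg (I^k)` for `k < 4` in quarter turns. -/
theorem arg_I_pow_mod (k : ℕ) :
    arg (I ^ (k % 4)) = (π / 2) * (if k % 4 = 0 then 0 else if k % 4 = 1 then 1 else if k % 4 = 2 then 2 else -1 : ℤ) := by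
  have hk : k % 4 < 4 := Nat.mod_lt _ (by norm_num)
  generalize hm : k % 4 = m at hk ⊢
  interval_cases m
  · simp
  · simp [Complex.arg_I]
  · simp [pow_two, Complex.arg_neg_one]
  · have : I ^ 3 = -I := by rw [pow_succ, pow_two, Complex.I_mul_I]; ring
    rw [this, Complex.arg_neg_I]; norm_num

/-- **`Im (anchorJump (I^d) (I^{d'})) = (π/2) · jumpVal d d'`.** -/
theorem im_anchorJump_I_pow (d d' : ℕ) : (anchorJump (I ^ d) (I ^ d')).im = (π / 2) * (jumpVal d d' : ℤ) := by
  rw [anchorJump_im, I_pow_div_I_pow, arg_I_pow_mod]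
  unfold jumpVal
  rfl

/-- The junction sum of a label list started from label `d₀`, in quarter turns. -/
def jumpSum : ℕ → List ℕ → ℤ
  | _, [] => 0
  | d₀, d₁ :: T => jumpVal d₀ d₁ + jumpSum d₁ T

/-- The last label of a label list started from `d₀`. -/
def lastLabel : ℕ → List ℕ → ℕ
  | d₀, [] => d₀
  | _, d₁ :: T => lastLabel d₁ T

/-- `apLastAnchor` of a segment piece list is `I^(last label)`. -/
theorem apLastAnchor_segList : ∀ (d₀ : ℕ) (T : List Seg), apLastAnchor (I ^ d₀) (segList T) = I ^ lastLabel d₀ (segLabels T)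
  | _, [] => rfl
  | _, (_, _, d) :: T => by simp [segList, segLabels, lastLabel, apLastAnchor_segList d T]

/-- **`Im (apJumps (I^{d₀}) (segList T)) = (π/2) · jumpSum d₀ (labels T)`.** -/
theorem im_apJumps_segList : ∀ (d₀ : ℕ) (T : List Seg),
    (apJumps (I ^ d₀) (segList T)).im = (π / 2) * (jumpSum d₀ (segLabels T) : ℤ)
  | _, [] => by simp [segList, segLabels, jumpSum]
  | d₀, (_, _, d) :: T => by
    simp only [segList, segLabels, jumpSum, apJumps, Complex.add_im, im_anchorJump_I_pow, im_apJumps_segList d T]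
    push_cast; ring

end Summit.RiemannHypothesis.RiemannHypothesis.Theorems.JensenPolynomials.LogBand.Canary

end
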